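import Summits.AtomisticToContinuum.Crystallization.Theorems.PalmUnimodularRigidityMinimiserShellsSlackCertificates
import Summits.AtomisticToContinuum.Crystallization.Theorems.PalmUnimodularRigidityMinimiserShellsCapDefs
import Summits.AtomisticToContinuum.Crystallization.Theorems.ChargedEnergyGap.Negative.BlocksBound

/-!
# Cap assembly, part A: the defect transport as a transfer, and the cap bonus off the phase slabs
(line `octahedral-annulus-mandate` of crux `MinimiserShells`, stmt-AtomisticToContinuum-9225; lemmas for
stub `stub_capAssembly`)

Route `PalmUnimodularRigidity`, crux decl
`Summit.AtomisticToContinuum.Crystallization.Theses.PalmUnimodularRigidity.MinimiserShells`.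

The stub `stub_capAssembly` (part B, `…CapAssembly.lean`) assembles the cap certificates of the line from
the finite cap inequality: next to the random-grid transport `EnergyFloor.transport δ₀ L` of item 9229 the
root sends the DEFECT TRANSPORT (surcharge `c / #cell` to every cell-mate whose re-rooted cell cluster is
capless, read through a measurable proxy `B` of `Capped`).  This file holds the lemmas which do not involve
the certificate bookkeeping:

* `neg_cst_le_eStar`: at the class parameter `δ₀ ≤ 1/20` the transported constant dominates `−e*`
  (`C_{δ₀} = 250/12·δ₀⁻⁶ ≥ 2³²/12 ≥ −e*`, the crude block bound `Blocks.neg_le_energyPerParticle`);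
* `defect_le`, `defect_eq_zero_of_lt`: on rooted hard-core inputs the defect transport is bounded by
  `c · vol [0,1)³` (the root's cell has mass `≥ 1`) and it has range `2L` (cells lie in `B̄(0, 2L)`);
* `measurable_recv`: a jointly measurable transfer, re-rooted at the sending atom, is measurable in the atom;
* `closedBall_two_subset_rootCell`, `volume_phaseDom_le_add`, `cap_bonus`: off six phase slabs of width `2/L`
  the ball `B̄(0, 2)` lies in the root's cell, where — `Capped` being local at radius `2`
  (`Cap.capped_congr_of_local`) and the cell cluster finite — "the cell cluster is not in `B`" is
  "the root is capless"; so at a CAPLESS root the received defect mass is `≥ c·(vol [0,1)³ − 6·(2/L))`.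
-/

noncomputable section

open MeasureTheory Filter Set
open scoped ENNReal BigOperators Topology

namespace Summit.AtomisticToContinuum.Crystallization.Theorems.PalmUnimodularRigidityMinimiserShells.CapAssembly

open Literature.Probability.Process (IsRootedHardCore count_restrict_singleton_ne_zero_iff)
open Literature.MathematicalPhysics.StatisticalMechanics (lennardJones UniformlyDiscrete)
open Summit.AtomisticToContinuum.Crystallization.Theorems.MinimiserShells.Negative.LoadBearing (eStar)
open Summit.AtomisticToContinuum.Crystallization.Theorems.MinimiserShells.Negative.Rootedness (E3)
open Summit.AtomisticToContinuum.Crystallization.Theorems.PalmUnimodularRigidityMinimiserShells.EnergyFloor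
open Summit.AtomisticToContinuum.Crystallization.Theorems.PalmUnimodularRigidityMinimiserShells.SlackCertificates
  (volume_slab_le)
open Summit.AtomisticToContinuum.Crystallization.Theorems.PalmUnimodularRigidityMinimiserShells.Cap
  (Capped capped_congr_of_local)

/-! ## The class parameter: `−C_{δ₀} ≤ e*` once `δ₀ ≤ 1/20` -/

/-- At a class parameter `0 < δ₀ ≤ 1/20` the transported constant dominates minus the ground-state energy:
`−C_{δ₀} = −250/12·δ₀⁻⁶ ≤ −2³²/12 ≤ e*` (crude block bound `Blocks.neg_le_energyPerParticle`). -/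
theorem neg_cst_le_eStar {δ₀ : ℝ} (h0 : 0 < δ₀) (h1 : δ₀ ≤ 1 / 20) : -cst δ₀ ≤ eStar := by
  have he : -(65536 ^ 2 / 12 : ℝ) ≤ eStar :=
    le_ciInf fun Q =>
      Summit.AtomisticToContinuum.Crystallization.Theorems.ChargedEnergyGapNegative.Blocks.neg_le_energyPerParticle Q
  have hinv : (20 : ℝ) ≤ δ₀⁻¹ := by
    have h := inv_anti₀ h0 h1
    norm_num at h
    exact h
  have hpow : (20 : ℝ) ^ 6 ≤ δ₀⁻¹ ^ 6 := pow_le_pow_left₀ (by norm_num) hinv 6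
  unfold cst
  nlinarith [hpow, he]

/-! ## The defect transport: bounded on hard-core inputs, of range `2L` -/

/-- **The defect transport is bounded on rooted hard-core configurations** by `c · vol [0,1)³`: the
indicator is at most `c` and the root's cell has mass `≥ 1` (it holds the root). -/
theorem defect_le {B : Set (Measure E3)} {c δ L : ℝ} (hδ : 0 < δ) {ν : Measure E3}
    (hν : IsRootedHardCore δ ν) (y : E3) :
    (∫⁻ v in phaseDom, (rootCell L v).indicator (fun w => Bᶜ.indicator (fun _ => ENNReal.ofReal c)
      (((trunc δ ν).restrict (rootCell L v)).map (fun z => z - w)) / trunc δ ν (rootCell L v)) y) ≤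
      ENNReal.ofReal c * volume phaseDom := by
  have hmem := mem_hcClass_of_hc hδ hν
  have hden : ∀ v, 1 ≤ trunc δ ν (rootCell L v) := fun v => by
    rw [trunc_of_mem hmem, ← hν.measure_zero_singleton]
    exact measure_mono (singleton_subset_iff.2 (zero_mem_rootCell L v))
  calc (∫⁻ v in phaseDom, (rootCell L v).indicator (fun w => Bᶜ.indicator (fun _ => ENNReal.ofReal c)
        (((trunc δ ν).restrict (rootCell L v)).map (fun z => z - w)) / trunc δ ν (rootCell L v)) y)
      ≤ ∫⁻ _ in phaseDom, ENNReal.ofReal c := lintegral_mono fun v => by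
        refine (indicator_le_self _ _ y).trans ?_
        calc Bᶜ.indicator (fun _ => ENNReal.ofReal c) (((trunc δ ν).restrict (rootCell L v)).map
              (fun z => z - y)) / trunc δ ν (rootCell L v)
            ≤ ENNReal.ofReal c / 1 := ENNReal.div_le_div (indicator_le_self _ _ _) (hden v)
          _ = ENNReal.ofReal c := div_one _
    _ = ENNReal.ofReal c * volume phaseDom := setLIntegral_const _ _

/-- **The defect transport has range `2L`**: nothing is sent beyond the root's cell, which lies in
`B̄(0, 2L)`. -/
theorem defect_eq_zero_of_lt {B : Set (Measure E3)} {c δ L : ℝ} (hL : 0 < L) (ν : Measure E3) {y : E3}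
    (hy : 2 * L < ‖y‖) :
    (∫⁻ v in phaseDom, (rootCell L v).indicator (fun w => Bᶜ.indicator (fun _ => ENNReal.ofReal c)
      (((trunc δ ν).restrict (rootCell L v)).map (fun z => z - w)) / trunc δ ν (rootCell L v)) y) = 0 := by
  have h : ∀ v, (rootCell L v).indicator (fun w => Bᶜ.indicator (fun _ => ENNReal.ofReal c)
      (((trunc δ ν).restrict (rootCell L v)).map (fun z => z - w)) / trunc δ ν (rootCell L v)) y = 0 :=
    fun v => indicator_of_notMem (fun hmem => by
      have := rootCell_subset_closedBall hL v hmem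
      rw [Metric.mem_closedBall, dist_zero_right] at this
      linarith) _
  calc (∫⁻ v in phaseDom, (rootCell L v).indicator (fun w => Bᶜ.indicator (fun _ => ENNReal.ofReal c)
        (((trunc δ ν).restrict (rootCell L v)).map (fun z => z - w)) / trunc δ ν (rootCell L v)) y)
      = ∫⁻ _ in phaseDom, 0 := lintegral_congr fun v => h v
    _ = 0 := lintegral_zero

/-- **A re-rooted jointly measurable transfer is measurable in the sending atom** (for a configuration of
the packing class): `y ↦ G (θ_y μ) (−y)` is measurable, through the s-finite truncated kernel
(`PalmUnimodularRigidity.measurable_map_sub_kernel`, as `SlackCertificates.measurable_transport_map_sub`). -/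
theorem measurable_recv {δ : ℝ} {G : Measure E3 → E3 → ℝ≥0∞} (hG : Measurable (Function.uncurry G))
    {μ : Measure E3} (hμ : μ ∈ hcClass δ) :
    Measurable fun y : E3 => G (μ.map fun z => z - y) (-y) := by
  have h1 : Measurable fun p : Measure E3 × E3 => ((truncKernel δ) p.1).map (fun z => z - p.2) :=
    Summit.AtomisticToContinuum.Crystallization.Theorems.PalmUnimodularRigidity.measurable_map_sub_kernel
      (truncKernel δ)
  have h2 : Measurable fun y : E3 => ((truncKernel δ) μ).map (fun z => z - y) :=
    h1.comp (measurable_const.prodMk measurable_id)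
  have hk : (truncKernel δ) μ = μ := by
    rw [truncKernel_apply, trunc_of_mem hμ]
  rw [hk] at h2
  have h3 : Measurable ((Function.uncurry G) ∘ fun y : E3 => (μ.map (fun z => z - y), -y)) :=
    hG.comp (h2.prodMk measurable_neg)
  rw [Function.comp_def] at h3
  exact h3

/-! ## Off the phase slabs the ball `B̄(0, 2)` lies in the root's cell -/

/-- If every phase coordinate lies in `(2/L, 1 − 2/L)` then the whole ball `B̄(0, 2)` shares the root's
cell (as in `SlackCertificates.phaseOut_le_of_norm_le`). -/
theorem closedBall_two_subset_rootCell {L : ℝ} (hL : 0 < L) {v : E3}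
    (hv : ∀ i, 2 / L < v i ∧ v i < 1 - 2 / L) : Metric.closedBall (0 : E3) 2 ⊆ rootCell L v := by
  intro w hw
  rw [mem_closedBall_zero_iff] at hw
  rw [mem_rootCell]
  funext i
  obtain ⟨h1, h2⟩ := hv i
  have hwi : |w i| ≤ 2 := (by simpa using PiLp.norm_apply_le w i : |w i| ≤ ‖w‖).trans hw
  have hwi' : |w i / L| ≤ 2 / L := by
    rw [abs_div, abs_of_pos hL]; exact div_le_div_of_nonneg_right hwi hL.le
  rw [abs_le] at hwi'
  have hL2 : 0 < 2 / L := by positivity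
  show ⌊w i / L - v i⌋ = ⌊(0 : E3) i / L - v i⌋
  rw [PiLp.zero_apply, zero_div, zero_sub]
  have hr : ⌊-v i⌋ = -1 := by
    rw [Int.floor_eq_iff]; push_cast; constructor <;> linarith
  rw [hr, Int.floor_eq_iff]; push_cast; constructor <;> linarith

/-- **The good phases fill the cube up to six slabs of width `2/L`**:
`vol [0,1)³ ≤ vol {v | ∀ i, 2/L < v i < 1 − 2/L} + 6·(2/L)`. -/
theorem volume_phaseDom_le_add (L : ℝ) :
    volume phaseDom ≤ volume {v : E3 | ∀ i, 2 / L < v i ∧ v i < 1 - 2 / L} + 6 * ENNReal.ofReal (2 / L) := by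
  -- the six slabs
  set A : Fin 3 → Set E3 := fun i => {v : E3 | (∀ j, 0 ≤ v j ∧ v j ≤ 1) ∧ 0 ≤ v i ∧ v i ≤ 2 / L} with hA
  set B : Fin 3 → Set E3 := fun i =>
    {v : E3 | (∀ j, 0 ≤ v j ∧ v j ≤ 1) ∧ 1 - 2 / L ≤ v i ∧ v i ≤ 1} with hB
  have hsub : phaseDom ⊆ {v : E3 | ∀ i, 2 / L < v i ∧ v i < 1 - 2 / L} ∪ ⋃ i, (A i ∪ B i) := by
    intro v hvD
    rw [mem_phaseDom] at hvD
    have hcube : ∀ j, 0 ≤ v j ∧ v j ≤ 1 := fun j => ⟨(hvD j).1, (hvD j).2.le⟩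
    by_cases hgood : ∀ i, 2 / L < v i ∧ v i < 1 - 2 / L
    · exact Or.inl hgood
    · right
      push Not at hgood
      obtain ⟨i, hi⟩ := hgood
      refine mem_iUnion.2 ⟨i, ?_⟩
      by_cases hlo : v i ≤ 2 / L
      · exact Or.inl ⟨hcube, (hvD i).1, hlo⟩
      · exact Or.inr ⟨hcube, hi (lt_of_not_ge hlo), (hvD i).2.le⟩
  have hvA : ∀ i, volume (A i) ≤ ENNReal.ofReal (2 / L) := fun i => by
    have := volume_slab_le i 0 (2 / L); rwa [sub_zero] at this
  have hvB : ∀ i, volume (B i) ≤ ENNReal.ofReal (2 / L) := fun i => by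
    have := volume_slab_le i (1 - 2 / L) 1; rwa [sub_sub_cancel] at this
  calc volume phaseDom
      ≤ volume ({v : E3 | ∀ i, 2 / L < v i ∧ v i < 1 - 2 / L} ∪ ⋃ i, (A i ∪ B i)) := measure_mono hsub
    _ ≤ volume {v : E3 | ∀ i, 2 / L < v i ∧ v i < 1 - 2 / L} + volume (⋃ i, (A i ∪ B i)) :=
        measure_union_le _ _
    _ ≤ volume {v : E3 | ∀ i, 2 / L < v i ∧ v i < 1 - 2 / L} + ∑ i, volume (A i ∪ B i) :=
        add_le_add le_rfl (measure_iUnion_fintype_le _ _)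
    _ ≤ volume {v : E3 | ∀ i, 2 / L < v i ∧ v i < 1 - 2 / L} + ∑ i, (volume (A i) + volume (B i)) :=
        add_le_add le_rfl (Finset.sum_le_sum fun i _ => measure_union_le _ _)
    _ ≤ volume {v : E3 | ∀ i, 2 / L < v i ∧ v i < 1 - 2 / L} +
          ∑ _i : Fin 3, (ENNReal.ofReal (2 / L) + ENNReal.ofReal (2 / L)) :=
        add_le_add le_rfl (Finset.sum_le_sum fun i _ => add_le_add (hvA i) (hvB i))
    _ = volume {v : E3 | ∀ i, 2 / L < v i ∧ v i < 1 - 2 / L} + 6 * ENNReal.ofReal (2 / L) := by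
        rw [Finset.sum_const, Finset.card_univ, Fintype.card_fin, nsmul_eq_mul]
        push_cast; ring

/-! ## The cap bonus -/

/-- **The cap bonus.**  Let `B` agree with `Capped` on finite counting measures.  At a CAPLESS rooted
`δ`-hard-core configuration `μ`, for every phase `v` off the six slabs the cell cluster `μ|C_v` is a finite
counting measure with the same atoms as `μ` in `B̄(0, 2) ⊆ C_v`, hence capless (`Cap.capped_congr_of_local`),
hence not in `B`; so the received defect mass `∫_{[0,1)³} c·1[μ|C_v ∉ B] dv` is at least
`c·vol [0,1)³ − c·6·(2/L)`. -/
theorem cap_bonus {B : Set (Measure E3)}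
    (hBcap : ∀ F : Set E3, F.Finite →
      ((Measure.count : Measure E3).restrict F ∈ B ↔ Capped ((Measure.count : Measure E3).restrict F)))
    (c : ℝ) {δ L : ℝ} (hδ : 0 < δ) (hL : 0 < L) {μ : Measure E3} (hμ : IsRootedHardCore δ μ)
    (hcap : ¬ Capped μ) :
    ENNReal.ofReal c * volume phaseDom ≤
      (∫⁻ v in phaseDom, Bᶜ.indicator (fun _ => ENNReal.ofReal c) (μ.restrict (rootCell L v))) +
        ENNReal.ofReal c * (6 * ENNReal.ofReal (2 / L)) := by
  obtain ⟨S, -, hsep, rfl⟩ := hμ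
  set Good : Set E3 := {v : E3 | ∀ i, 2 / L < v i ∧ v i < 1 - 2 / L} with hGood
  have hGm : MeasurableSet Good := by
    have h : Good = ⋂ i, (fun v : E3 => v i) ⁻¹' Ioo (2 / L) (1 - 2 / L) := by
      ext v
      simp only [hGood, mem_setOf_eq, mem_iInter, mem_preimage, mem_Ioo]
    rw [h]
    exact MeasurableSet.iInter fun i => measurable_coord i measurableSet_Ioo
  have hL2 : 0 < 2 / L := by positivity
  have hGsub : Good ⊆ phaseDom := fun v hv => mem_phaseDom.2 fun i => by
    have hvi : 2 / L < v i ∧ v i < 1 - 2 / L := hv i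
    constructor <;> linarith [hvi.1, hvi.2]
  -- on the good phases the cell cluster decides `Capped`
  have hval : ∀ v ∈ Good, Bᶜ.indicator (fun _ => ENNReal.ofReal c)
      (((Measure.count : Measure E3).restrict S).restrict (rootCell L v)) = ENNReal.ofReal c := by
    intro v hv
    have hball := closedBall_two_subset_rootCell hL (v := v) hv
    have hfin : (rootCell L v ∩ S).Finite :=
      (UniformlyDiscrete.finite_inter_closedBall ⟨δ, hδ, hsep⟩ 0 (2 * L)).subset fun z hz =>
        ⟨hz.2, rootCell_subset_closedBall hL v hz.1⟩
    rw [Measure.restrict_restrict (measurableSet_rootCell L v)]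
    refine indicator_of_mem (mem_compl fun hB => hcap ?_) _
    have hcapF : Capped ((Measure.count : Measure E3).restrict (rootCell L v ∩ S)) := (hBcap _ hfin).1 hB
    refine (capped_congr_of_local (μ := (Measure.count : Measure E3).restrict (rootCell L v ∩ S))
      (ν := (Measure.count : Measure E3).restrict S) fun w hw => ?_).1 hcapF
    rw [count_restrict_singleton_ne_zero_iff, count_restrict_singleton_ne_zero_iff]
    exact ⟨fun h => h.2, fun h => ⟨hball (mem_closedBall_zero_iff.2 hw), h⟩⟩
  have hint : ENNReal.ofReal c * volume Good ≤ ∫⁻ v in phaseDom, Bᶜ.indicator (fun _ => ENNReal.ofReal c)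
      (((Measure.count : Measure E3).restrict S).restrict (rootCell L v)) := by
    calc ENNReal.ofReal c * volume Good
        = ENNReal.ofReal c * ((volume : Measure E3).restrict phaseDom) Good := by
          rw [Measure.restrict_apply hGm, inter_eq_left.2 hGsub]
      _ = ∫⁻ v in phaseDom, Good.indicator (fun _ => ENNReal.ofReal c) v :=
          (lintegral_indicator_const hGm _).symm
      _ ≤ _ := lintegral_mono fun v => by
          by_cases hv : v ∈ Good
          · rw [indicator_of_mem hv, hval v hv]
          · rw [indicator_of_notMem hv]; exact zero_le
  calc ENNReal.ofReal c * volume phaseDom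
      ≤ ENNReal.ofReal c * (volume Good + 6 * ENNReal.ofReal (2 / L)) :=
        mul_le_mul' le_rfl (volume_phaseDom_le_add L)
    _ = ENNReal.ofReal c * volume Good + ENNReal.ofReal c * (6 * ENNReal.ofReal (2 / L)) := mul_add _ _ _
    _ ≤ _ := add_le_add hint le_rfl


/-! ## Registered marker -/

/-- Registered sub-goal `stub_capAssembly_part01` (helper part 1/3 of `stub_capAssembly`, line
`octahedral-annulus-mandate`): the CAP BONUS `cap_bonus`, closed form — at a capless rooted hard-core
configuration the received defect mass is at least `c·(vol [0,1)³ − 6·(2/L))`. -/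
theorem stub_capAssembly_part01 : ∀ (B : Set (Measure E3)), (∀ F : Set E3, F.Finite → ((Measure.count : Measure E3).restrict F ∈ B ↔ Capped ((Measure.count : Measure E3).restrict F))) → ∀ (c δ L : ℝ), 0 < δ → 0 < L → ∀ μ : Measure E3, IsRootedHardCore δ μ → ¬ Capped μ → ENNReal.ofReal c * volume phaseDom ≤ (∫⁻ v in phaseDom, Bᶜ.indicator (fun _ => ENNReal.ofReal c) (μ.restrict (rootCell L v))) + ENNReal.ofReal c * (6 * ENNReal.ofReal (2 / L)) :=
  fun _ hBcap c _ _ hδ hL _ hμ hcap => cap_bonus hBcap c hδ hL hμ hcap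

end Summit.AtomisticToContinuum.Crystallization.Theorems.PalmUnimodularRigidityMinimiserShells.CapAssembly

end
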